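import Literature.Geometry.Lorentzian.CoordHarmonicCurvature
import Literature.Geometry.Lorentzian.ConformalCoordCurvature
import HarnessLib

/-!
# The Weyl curvature endomorphism of metric components, its total trace-freeness, and
# `∇W = ∇R` (hence harmonic Weyl tensor) for Einstein components

Continuation of `CoordCurvature.lean` / `CoordBianchi.lean` / `CoordHarmonicCurvature.lean`
(namespace `MetricCoord`: components `G : E → (E →L E →L ℝ)` of a pseudo-Riemannian metric on a
finite-dimensional real normed space `E`, `dim E = m`, smooth, symmetric and nondegenerate on an
open set `V` (`IsMetricOn G V`); `♯ = sharpAt`, Christoffel map `chrAt`, curvature endomorphism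
`riemAt` with `R(X,Y)Z`, Ricci form `ricAt` (`Ric(Y,Z) = tr (X ↦ R(X,Y)Z)`), scalar curvature
`scalAt`, covariant derivative `covRiemAt` of `R` along constant fields).

* `MetricCoord.weylAt G x X Y : E →L[ℝ] E` — **the Weyl curvature endomorphism**
  `W(X,Y)Z = R(X,Y)Z − (1/(m−2)) (Ric(Y,Z) X − Ric(X,Z) Y + G(Y,Z) ♯Ric(X,·) − G(X,Z) ♯Ric(Y,·))
            + (S/((m−1)(m−2))) (G(Y,Z) X − G(X,Z) Y)`,
  i.e. the endomorphism form of `W = R − P ⊙ g`, `P = (1/(m−2))(Ric − (S/(2(m−1))) g)` the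
  Schouten tensor (Besse 1987, 1.116–1.117; lowered with `G`,
  `G(W(X,Y)Z, T) = Rm(X,Y,Z,T) − (1/(m−2))(Ric(X,T)G(Y,Z) + Ric(Y,Z)G(X,T) − Ric(X,Z)G(Y,T) − Ric(Y,T)G(X,Z))
   + (S/((m−1)(m−2)))(G(X,T)G(Y,Z) − G(X,Z)G(Y,T))`, `IsMetricOn.apply_weylAt` — exactly the
  orthonormal-frame formula `PseudoRiemannianMetric.weylFrame` of `Riemannian/WeylEnergy.lean` in
  the slot convention `Rm(X,Y,Z,T) = g(R(X,Y)Z, T)` of this tree); meaningful for `m ≥ 3`;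
* `weylAt_swap` (`W(Y,X) = −W(X,Y)`), `IsMetricOn.sum_coord_weylAt` — **`W` is totally
  trace-free**: `Σᵢ bⁱ(W(bᵢ,Y)Z) = 0` in any basis (Besse 1987, Thm. 1.114: `W ∈ Ker c`);
* `IsMetricOn.weylAt_of_einstein` — for EINSTEIN components `Ric = λ G` at `x`:
  `W(X,Y) = R(X,Y) − (λ/(m−1)) (G(Y,·) ⊗ X − G(X,·) ⊗ Y)` (Besse 1987, 1.118: `z = 0`);
* `MetricCoord.covWeylAt G x W X Y` — the covariant derivative of `W` along a constant field
  (`(∇_W W)(X,Y) = ∂_W W(X,Y) + Γ_W ∘ W(X,Y) − W(X,Y) ∘ Γ_W − W(Γ(W,X),Y) − W(X,Γ(W,Y))`, the pattern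
  of `covRiemAt`), `IsMetricOn.covWeylAt_eq_covRiemAt_of_einstein` — **for Einstein components
  on `V`, `∇W = ∇R`** (the difference `(λ/(m−1)) (G(Y,·)⊗X − G(X,·)⊗Y)` is parallel, `∇G = 0`),
  and `IsMetricOn.sum_coord_covWeylAt_eq_zero_of_einstein` — **Einstein components have harmonic
  Weyl tensor**, `Σᵢ bⁱ((∇_{bᵢ} W)(X,Y)Z) = 0` (Besse 1987, 16.4–16.5 and 16.24 (i); the step
  "(div) `∇^a W⁺_{abcd} = 0`" of Gursky–LeBrun 1999, §3, before its projection to `Λ⁺`), from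
  `sum_coord_covRiemAt_first_eq_zero_of_einstein` (`CoordHarmonicCurvature.lean`).

Everything is proved; the file introduces two definitions (`weylAt`, `covWeylAt`) and no statement of
`Prop` type.

## References

* A. L. Besse, *Einstein manifolds*, Springer 1987, 1.110, 1.114, 1.116–1.118 (Weyl tensor,
  Schouten tensor, trace-freeness), 16.3–16.5, 16.24 (i) (Einstein ⟹ harmonic curvature and
  harmonic Weyl tensor). [Besse1987]
* B. O'Neill, *Semi-Riemannian geometry*, Academic Press 1983, Ch. 3, Prop. 3.13, p. 60, Prop. 3.37.
  [ONeill1983]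
* M. J. Gursky, C. LeBrun, Ann. Global Anal. Geom. 17 (1999) 315–328 (arXiv:math/9807055), §3,
  (div). [GurskyLebrun1999]
-/

noncomputable section

set_option maxSynthPendingDepth 3

open Set Filter ContinuousLinearMap Module
open scoped Topology ContDiff

namespace Literature.Geometry.Lorentzian

namespace MetricCoord

variable {E : Type*} [NormedAddCommGroup E] [NormedSpace ℝ E] [FiniteDimensional ℝ E]

section Weyl

variable (G : E → E →L[ℝ] E →L[ℝ] ℝ)

/-- **The Weyl curvature endomorphism** of the components `G` at `x` (`m = dim E ≥ 3`):
`W(X,Y)Z = R(X,Y)Z − (1/(m−2)) (Ric(Y,Z) X − Ric(X,Z) Y + G(Y,Z) ♯Ric(X,·) − G(X,Z) ♯Ric(Y,·))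
          + (S/((m−1)(m−2))) (G(Y,Z) X − G(X,Z) Y)`,
the endomorphism form of `W = R − P ⊙ g` with the Schouten tensor `P` (Besse 1987, 1.116–1.117;
for `m ≤ 2` the coefficients are Lean's junk `x/0 = 0`). [cite: Besse1987, (1.116)–1.117] -/
def weylAt (x X Y : E) : E →L[ℝ] E :=
  riemAt G x X Y
    - ((Module.finrank ℝ E : ℝ) - 2)⁻¹ •
        ((ricAt G x Y).smulRight X - (ricAt G x X).smulRight Y
          + (G x Y).smulRight (sharpAt G x (ricAt G x X))
          - (G x X).smulRight (sharpAt G x (ricAt G x Y)))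
    + (scalAt G x / (((Module.finrank ℝ E : ℝ) - 1) * ((Module.finrank ℝ E : ℝ) - 2))) •
        ((G x Y).smulRight X - (G x X).smulRight Y)

/-- Unfolding lemma for `weylAt`. [cite: Besse1987, (1.116)–1.117] -/
theorem weylAt_apply (x X Y Z : E) :
    weylAt G x X Y Z =
      riemAt G x X Y Z
        - ((Module.finrank ℝ E : ℝ) - 2)⁻¹ •
            (ricAt G x Y Z • X - ricAt G x X Z • Y
              + G x Y Z • sharpAt G x (ricAt G x X) - G x X Z • sharpAt G x (ricAt G x Y))
        + (scalAt G x / (((Module.finrank ℝ E : ℝ) - 1) * ((Module.finrank ℝ E : ℝ) - 2))) •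
            (G x Y Z • X - G x X Z • Y) := by
  simp only [weylAt, _root_.add_apply, _root_.sub_apply, _root_.smul_apply,
    ContinuousLinearMap.smulRight_apply]

/-- `W(Y,X) = −W(X,Y)`. [cite: Besse1987, (1.116)–1.117] -/
theorem weylAt_swap (x X Y : E) : weylAt G x Y X = -weylAt G x X Y := by
  ext Z
  simp only [weylAt_apply, riemAt_swap G x X Y, _root_.neg_apply]
  module

variable {G} {V : Set E} {x : E}

/-- **`W` lowered with the metric**:
`G(W(X,Y)Z, T) = G(R(X,Y)Z,T) − (1/(m−2))(Ric(X,T)G(Y,Z) + Ric(Y,Z)G(X,T) − Ric(X,Z)G(Y,T) − Ric(Y,T)G(X,Z))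
  + (S/((m−1)(m−2)))(G(X,T)G(Y,Z) − G(X,Z)G(Y,T))` — the formula of
`PseudoRiemannianMetric.weylFrame` (`Riemannian/WeylEnergy.lean`) with `Rm(X,Y,Z,T) = g(R(X,Y)Z,T)`.
[cite: Besse1987, (1.116)–1.117] -/
theorem IsMetricOn.apply_weylAt (hG : IsMetricOn G V) (hx : x ∈ V) (X Y Z T : E) :
    G x (weylAt G x X Y Z) T =
      G x (riemAt G x X Y Z) T
        - ((Module.finrank ℝ E : ℝ) - 2)⁻¹ *
            (ricAt G x X T * G x Y Z + ricAt G x Y Z * G x X T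
              - ricAt G x X Z * G x Y T - ricAt G x Y T * G x X Z)
        + (scalAt G x / (((Module.finrank ℝ E : ℝ) - 1) * ((Module.finrank ℝ E : ℝ) - 2))) *
            (G x X T * G x Y Z - G x X Z * G x Y T) := by
  have hi := hG.isInvertible x hx
  rw [weylAt_apply]
  simp only [map_add, map_sub, map_smul, _root_.add_apply, _root_.sub_apply,
    _root_.smul_apply, smul_eq_mul, apply_sharpAt_apply hi]
  ring

end Weyl

/-! ### Total trace-freeness -/

section TraceFree

variable {ι : Type*} [Fintype ι] {G : E → E →L[ℝ] E →L[ℝ] ℝ} {V : Set E} {x : E} (b : Basis ι ℝ E)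

/-- `Σᵢ bⁱ(♯Ric(bᵢ,·)) = tr (♯ ∘ Ric) = S`. [cite: ONeill1983, Ch. 3, Def. 3.53] -/
theorem sum_coord_sharpAt_ricAt : ∑ i, b.coord i (sharpAt G x (ricAt G x (b i))) = scalAt G x := by
  rw [scalAt, mtrAt, trace_eq_sum_coord b]
  rfl

/-- **The Weyl endomorphism is totally trace-free**: `Σᵢ bⁱ(W(bᵢ, Y) Z) = 0` (its Ricci
contraction vanishes; Besse 1987, Thm. 1.114: `W ∈ Ker c`), for `m = dim E ≥ 3`.
[cite: Besse1987, Thm. 1.114 and (1.116)] -/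
theorem IsMetricOn.sum_coord_weylAt (hG : IsMetricOn G V) (hx : x ∈ V)
    (hm : 3 ≤ Module.finrank ℝ E) (Y Z : E) :
    ∑ i, b.coord i (weylAt G x (b i) Y Z) = 0 := by
  have hi := hG.isInvertible x hx
  have hcard : (Fintype.card ι : ℝ) = Module.finrank ℝ E := by
    exact_mod_cast (Module.finrank_eq_card_basis b).symm
  have h3 : (3 : ℝ) ≤ Module.finrank ℝ E := by exact_mod_cast hm
  have hm2 : (Module.finrank ℝ E : ℝ) - 2 ≠ 0 := by linarith
  have hm1 : (Module.finrank ℝ E : ℝ) - 1 ≠ 0 := by linarith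
  have t0 : ∑ i, b.coord i (riemAt G x (b i) Y Z) = ricAt G x Y Z := (ricAt_eq_sum_coord b Y Z).symm
  have t2 : ∑ i, ricAt G x (b i) Z * b.coord i Y = ricAt G x Y Z := by
    have := sum_clm_mul_coord b ((ricAt G x).flip Z) Y
    simpa only [ContinuousLinearMap.flip_apply] using this
  have t4 : ∑ i, G x (b i) Z * b.coord i (sharpAt G x (ricAt G x Y)) = ricAt G x Y Z := by
    have := sum_clm_mul_coord b ((G x).flip Z) (sharpAt G x (ricAt G x Y))
    simp only [ContinuousLinearMap.flip_apply] at this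
    rw [this, apply_sharpAt_apply hi]
  have t6 : ∑ i, G x (b i) Z * b.coord i Y = G x Y Z := by
    have := sum_clm_mul_coord b ((G x).flip Z) Y
    simpa only [ContinuousLinearMap.flip_apply] using this
  have expand : ∀ i, b.coord i (weylAt G x (b i) Y Z) =
      b.coord i (riemAt G x (b i) Y Z)
        - ((Module.finrank ℝ E : ℝ) - 2)⁻¹ *
          (ricAt G x Y Z * b.coord i (b i) - ricAt G x (b i) Z * b.coord i Y
            + G x Y Z * b.coord i (sharpAt G x (ricAt G x (b i)))
            - G x (b i) Z * b.coord i (sharpAt G x (ricAt G x Y)))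
        + (scalAt G x / (((Module.finrank ℝ E : ℝ) - 1) * ((Module.finrank ℝ E : ℝ) - 2))) *
          (G x Y Z * b.coord i (b i) - G x (b i) Z * b.coord i Y) := fun i ↦ by
    rw [weylAt_apply]
    simp only [map_add, map_sub, map_smul, smul_eq_mul]
  simp only [expand, Finset.sum_add_distrib, Finset.sum_sub_distrib, ← Finset.mul_sum]
  rw [t0, sum_coord_self, hcard, t2, sum_coord_sharpAt_ricAt b, t4, t6]
  field_simp
  ring

end TraceFree

/-! ### Einstein components: `W = R − (λ/(m−1)) (G(Y,·)⊗X − G(X,·)⊗Y)` and `∇W = ∇R` -/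

section Einstein

variable [CompleteSpace E] {G : E → E →L[ℝ] E →L[ℝ] ℝ} {V : Set E} {x : E}

omit [CompleteSpace E] in
/-- **The Weyl endomorphism of Einstein components**: if `Ric_x = λ G_x` (so `S = mλ`,
`♯Ric(X,·) = λ X`) then `W(X,Y) = R(X,Y) − (λ/(m−1)) (G(Y,·) ⊗ X − G(X,·) ⊗ Y)` for `m ≥ 3`
(Besse 1987, 1.118: for `z = 0`, `R = (s/(2n(n−1))) g ⊙ g + W`). [cite: Besse1987, 1.118] -/
theorem IsMetricOn.weylAt_of_einstein (hG : IsMetricOn G V) (hx : x ∈ V)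
    (hm : 3 ≤ Module.finrank ℝ E) {lam : ℝ} (hE : ricAt G x = lam • G x) (X Y : E) :
    weylAt G x X Y =
      riemAt G x X Y - (lam / ((Module.finrank ℝ E : ℝ) - 1)) •
        ((G x Y).smulRight X - (G x X).smulRight Y) := by
  have hi := hG.isInvertible x hx
  have h3 : (3 : ℝ) ≤ Module.finrank ℝ E := by exact_mod_cast hm
  have hm2 : (Module.finrank ℝ E : ℝ) - 2 ≠ 0 := by linarith
  have hm1 : (Module.finrank ℝ E : ℝ) - 1 ≠ 0 := by linarith
  have hS : scalAt G x = Module.finrank ℝ E * lam := by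
    rw [scalAt, hE, mtrAt_smul, mtrAt_self hi, mul_comm]
  have hsharp : ∀ Z : E, sharpAt G x (ricAt G x Z) = lam • Z := fun Z ↦ by
    rw [hE, _root_.smul_apply, map_smul, sharpAt_apply hi]
  have hRic : ∀ U Z : E, ricAt G x U Z = lam * G x U Z := fun U Z ↦ by
    rw [hE, _root_.smul_apply, _root_.smul_apply, smul_eq_mul]
  ext Z
  rw [weylAt_apply, hsharp, hsharp, hRic, hRic, hS]
  simp only [_root_.sub_apply, _root_.smul_apply, ContinuousLinearMap.smulRight_apply]
  match_scalars <;> field_simp <;> ring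

/-- **The covariant derivative of the Weyl endomorphism along a constant field** `W₀`:
`(∇_{W₀} W)(X,Y) = ∂_{W₀} W(X,Y) + Γ_{W₀} ∘ W(X,Y) − W(X,Y) ∘ Γ_{W₀} − W(Γ(W₀,X),Y) − W(X,Γ(W₀,Y))`
(the pattern of `covRiemAt`; O'Neill 1983, Ch. 2, Prop. 2.13 on constant fields).
[cite: ONeill1983, Ch. 2, Prop. 2.13] -/
def covWeylAt (G : E → E →L[ℝ] E →L[ℝ] ℝ) (x W₀ X Y : E) : E →L[ℝ] E :=
  fderiv ℝ (fun y ↦ weylAt G y X Y) x W₀ + (chrAt G x W₀).comp (weylAt G x X Y)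
    - (weylAt G x X Y).comp (chrAt G x W₀) - weylAt G x (chrAt G x W₀ X) Y
    - weylAt G x X (chrAt G x W₀ Y)

omit [FiniteDimensional ℝ E] [CompleteSpace E] in
/-- The derivative of `y ↦ G_y(U, ·) ⊗ X'` at `x`: `W₀ ↦ (∂_{W₀}G)(U, ·) ⊗ X'`. [folklore] -/
theorem IsMetricOn.hasFDerivAt_smulRight (hG : IsMetricOn G V) (hx : x ∈ V) (U X' : E) :
    HasFDerivAt (fun y ↦ (G y U).smulRight X')
      (((ContinuousLinearMap.smulRightL ℝ E E).flip X').comp ((fderiv ℝ G x).flip U)) x := by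
  have hd : HasFDerivAt (fun y ↦ G y U) ((fderiv ℝ G x).flip U) x := by
    have h := hasFDerivAt_clm_apply_const (hG.differentiableAt hx).hasFDerivAt U
    convert h using 1
  exact ((ContinuousLinearMap.smulRightL ℝ E E).flip X').hasFDerivAt.comp x hd

omit [FiniteDimensional ℝ E] [CompleteSpace E] in
/-- The derivative of the correction tensor `y ↦ T_y(X,Y) = G_y(Y,·) ⊗ X − G_y(X,·) ⊗ Y`:
`∂_{W₀} T(X,Y) = (∂_{W₀}G)(Y,·) ⊗ X − (∂_{W₀}G)(X,·) ⊗ Y`. [folklore] -/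
theorem IsMetricOn.fderiv_correction (hG : IsMetricOn G V) (hx : x ∈ V) (W₀ X Y : E) :
    fderiv ℝ (fun y ↦ (G y Y).smulRight X - (G y X).smulRight Y) x W₀ =
      (fderiv ℝ G x W₀ Y).smulRight X - (fderiv ℝ G x W₀ X).smulRight Y := by
  rw [((hG.hasFDerivAt_smulRight hx Y X).fun_sub (hG.hasFDerivAt_smulRight hx X Y)).fderiv]
  ext Z
  simp [ContinuousLinearMap.smulRightL, ContinuousLinearMap.flip_apply]

omit [FiniteDimensional ℝ E] [CompleteSpace E] in
/-- The correction tensor `T(X,Y) = G(Y,·) ⊗ X − G(X,·) ⊗ Y` is PARALLEL: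
`∂_{W₀} T(X,Y) + Γ_{W₀} ∘ T(X,Y) − T(X,Y) ∘ Γ_{W₀} − T(Γ(W₀,X),Y) − T(X,Γ(W₀,Y)) = 0`
(metric compatibility `∇G = 0`, O'Neill 1983, Ch. 3, Prop. 3.13, and torsion-freeness
`Γ(W₀,X) = Γ(X,W₀)`). [cite: ONeill1983, Ch. 3, Prop. 3.13] -/
theorem IsMetricOn.cov_correction_eq_zero (hG : IsMetricOn G V) (hx : x ∈ V) (W₀ X Y : E) :
    fderiv ℝ (fun y ↦ (G y Y).smulRight X - (G y X).smulRight Y) x W₀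
      + (chrAt G x W₀).comp ((G x Y).smulRight X - (G x X).smulRight Y)
      - ((G x Y).smulRight X - (G x X).smulRight Y).comp (chrAt G x W₀)
      - ((G x Y).smulRight (chrAt G x W₀ X) - (G x (chrAt G x W₀ X)).smulRight Y)
      - ((G x (chrAt G x W₀ Y)).smulRight X - (G x X).smulRight (chrAt G x W₀ Y)) = 0 := by
  rw [hG.fderiv_correction hx W₀ X Y]
  ext Z
  simp only [_root_.sub_apply, _root_.add_apply, ContinuousLinearMap.comp_apply,
    ContinuousLinearMap.smulRight_apply, _root_.zero_apply, map_sub, map_smul,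
    hG.fderiv_eq_chrAt hx W₀ Y Z, hG.fderiv_eq_chrAt hx W₀ X Z]
  rw [hG.symm x hx Y (chrAt G x W₀ Z), hG.symm x hx X (chrAt G x W₀ Z)]
  rw [hG.symm x hx (chrAt G x W₀ Z) Y, hG.symm x hx (chrAt G x W₀ Z) X]
  module

/-- **For Einstein components, `∇W = ∇R`**: if `Ric = λ G` on `V` (`m ≥ 3`) then
`(∇_{W₀} W)(X,Y) = (∇_{W₀} R)(X,Y)` at every point of `V` — on `V` the Weyl endomorphism is
`R − (λ/(m−1)) T` with `T` parallel (`cov_correction_eq_zero`). [cite: Besse1987, 16.4–16.5] -/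
theorem IsMetricOn.covWeylAt_eq_covRiemAt_of_einstein (hG : IsMetricOn G V) (hx : x ∈ V)
    (hm : 3 ≤ Module.finrank ℝ E) {lam : ℝ} (hE : ∀ y ∈ V, ricAt G y = lam • G y) (W₀ X Y : E) :
    covWeylAt G x W₀ X Y = covRiemAt G x W₀ X Y := by
  set c : ℝ := lam / ((Module.finrank ℝ E : ℝ) - 1) with hc
  have hW : ∀ y ∈ V, ∀ X' Y' : E, weylAt G y X' Y' =
      riemAt G y X' Y' - c • ((G y Y').smulRight X' - (G y X').smulRight Y') :=
    fun y hy X' Y' ↦ hG.weylAt_of_einstein hy hm (hE y hy) X' Y'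
  have hev : (fun y ↦ weylAt G y X Y) =ᶠ[𝓝 x]
      fun y ↦ riemAt G y X Y - c • ((G y Y).smulRight X - (G y X).smulRight Y) :=
    (hG.eventually_mem hx).mono fun y hy ↦ hW y hy X Y
  have hdR : DifferentiableAt ℝ (fun y ↦ riemAt G y X Y) x := hG.differentiableAt_riemAt hx X Y
  have hdT : DifferentiableAt ℝ (fun y ↦ (G y Y).smulRight X - (G y X).smulRight Y) x :=
    ((hG.hasFDerivAt_smulRight hx Y X).fun_sub (hG.hasFDerivAt_smulRight hx X Y)).differentiableAt
  have hfd : fderiv ℝ (fun y ↦ weylAt G y X Y) x W₀ =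
      fderiv ℝ (fun y ↦ riemAt G y X Y) x W₀ -
        c • fderiv ℝ (fun y ↦ (G y Y).smulRight X - (G y X).smulRight Y) x W₀ := by
    rw [hev.fderiv_eq, fderiv_fun_sub hdR (hdT.fun_const_smul c), fderiv_fun_const_smul hdT]
    rfl
  have hT := hG.cov_correction_eq_zero hx W₀ X Y
  have key : covWeylAt G x W₀ X Y - covRiemAt G x W₀ X Y =
      -(c • (fderiv ℝ (fun y ↦ (G y Y).smulRight X - (G y X).smulRight Y) x W₀
        + (chrAt G x W₀).comp ((G x Y).smulRight X - (G x X).smulRight Y)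
        - ((G x Y).smulRight X - (G x X).smulRight Y).comp (chrAt G x W₀)
        - ((G x Y).smulRight (chrAt G x W₀ X) - (G x (chrAt G x W₀ X)).smulRight Y)
        - ((G x (chrAt G x W₀ Y)).smulRight X - (G x X).smulRight (chrAt G x W₀ Y)))) := by
    simp only [covWeylAt, covRiemAt, hfd, hW x hx]
    simp only [ContinuousLinearMap.comp_sub, ContinuousLinearMap.sub_comp, ContinuousLinearMap.comp_smul,
      ContinuousLinearMap.smul_comp, smul_add, smul_sub]
    abel
  rw [← sub_eq_zero, key, hT, smul_zero, neg_zero]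

variable {ι : Type*} [Fintype ι] (b : Basis ι ℝ E)

/-- **Einstein metric components have harmonic Weyl tensor**: if `Ric = λ G` on `V` (`m ≥ 3`)
then `Σᵢ bⁱ((∇_{bᵢ} W)(X,Y)Z) = 0` at every point of `V` (Besse 1987, 16.4–16.5, 16.24 (i):
`Dr = 0 ⟹ δR = 0` and `δW = 0`; Gursky–LeBrun 1999, §3, (div), before projecting to `W⁺`):
`∇W = ∇R` (`covWeylAt_eq_covRiemAt_of_einstein`) and `R` is harmonic
(`sum_coord_covRiemAt_first_eq_zero_of_einstein`, `CoordHarmonicCurvature.lean`).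
[cite: Besse1987, 16.5] [cite: GurskyLebrun1999, §3, (div)] -/
theorem IsMetricOn.sum_coord_covWeylAt_eq_zero_of_einstein (hG : IsMetricOn G V) (hx : x ∈ V)
    (hm : 3 ≤ Module.finrank ℝ E) {lam : ℝ} (hE : ∀ y ∈ V, ricAt G y = lam • G y) (X Y Z : E) :
    ∑ i, b.coord i (covWeylAt G x (b i) X Y Z) = 0 := by
  simp only [hG.covWeylAt_eq_covRiemAt_of_einstein hx hm hE]
  exact hG.sum_coord_covRiemAt_first_eq_zero_of_einstein b hx hE X Y Z

end Einstein

end MetricCoord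

end Literature.Geometry.Lorentzian

end
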